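import Literature.MathematicalPhysics.QuantumFieldTheory.Balaban1983to89.Node00.StepWeightsAtNoExpansion
import Summits.QuantumFields.YangMills.Theorems.BalabanUVNodesN11DiagonalPinAboveZero

/-!
# DAG node N11 — HISTORY (A) OF THE TWO-HISTORY OBSTRUCTION (director-ym №183 gate (g2)(A)): at the ALL-SMALL old term extended by
# `Ω_{k+1} = Λ_{k+1} = ∅`, def-T's resummed 𝐓-step weight VANISHES at every `(U, V′)` that is (3.2)-small on every χ_{k+1}-cube and
# (3.3)-small on every cube — while along the all-large-field diagonal (history (B), this seat's p534515) it is `≡ 1` at the SAME `(k, Y = T, U, V′)`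

Cell `pub-ymgap`, YM-PLAN Track A (HUMAN RULING D-0062), seat `pub-ymgap-dag-n11-d` (g8; R134 fan-out seat N11 [B14], strategy s2), route `BalabanUVNodes`
rev 23, item K1⁶ `StabilityBAtRecordR13SepCoPR` = stmt-QuantumFields-20507 (helper, count-neutral).  [III] = [Balaban1988Convergent].  Over n02-b∕def-T's
`Node00/StepWeightsOfRecord` (FILE 1: `wOfRecord`, the labels `(P,Q,R,S)_{k+1}`, (3.5) `OmegaOfLabel`, the pinned (3.2)∕(3.3) factors `aWeight`∕`bWeight`),
this seat's `Node00/StepWeightsAtNoExpansion` (g5, p502303: the fibre of the index map over a no-expansion new sequence; layer algebra) and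
`…N11DiagonalPinAboveZero` (g7, p534515: history (B), `wOfRecord_seqAllLarge_succ_eq_one`).

WHY THIS FILE (director-ym №183 (2) gate (g2), №186 (2), №187 (3)(ii); node00-def-T's memo `LOCATED-9-ZetaHistoryBlind-DESIGN-g23.md` §2).  FINDING №9:
the v1.6 residual 𝐓-weight slot `Stage13RParams.Zr p` is run-indexed but HISTORY-BLIND — its generation-`k` factor `ζ0_k(Y)(ω)` reads `(p; k, Y = Ω_{k+1}ᶜ; ω)` —
while print's `ζ(Ω_{k+1}ᶜ)` ([III] p.267, (3.23) p.270) is a factor OF THE TERM, built from the term's `Z_k = Λ_kᶜ` by (3.2)–(3.5).  The kernel half of the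
finding is a TWO-HISTORY computation: two new histories of length `k+1 ≥ 2` with the SAME `Ω_{k+1} = ∅` (so the same slot argument `Y = T`) at which def-T's
resummed step weight `w_k(s′)(U, V′) = Σ_{t : σ(init s′) t = s′} ω(init s′) t (U, V′)` — the natural (print) pin of the generation-`k` factor — takes DIFFERENT
values: (B) the all-large-field diagonal, `w ≡ 1` (p534515); (A) the all-small old term (`Ω_j = Λ_j = T`, `j ≤ k`) extended by `(∅, ∅)`, where `w = 0` on the
(3.2)∕(3.3)-small configurations.  This file lands (A) and the juxtaposition; nothing history-blind and pointwise can serve both (director-ym №183: ⇒ H1ʰ, the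
v1.7 history-indexed slot `Zh p n s.Ω s.Λ`).

THE COMPUTATION (memo §2, n11-d g7's hand computation, here in the kernel).  Let `s = init s′` have `Λ_k = T` (`k ≥ 1`).  Then the term's large-field region
`Z_k = Λ_kᶜ` is EMPTY, so `Z̃_k^{∼4} = ∅`, the (3.2) window `W32 = T`, `B^{k+1}(∅) = T`, and (3.5) gives `Ω_{k+1}(∅, ∅) = T` before the guard; the guard
`Λ_k ∩ W32 ∩ (∪∅)ᶜ` is `T`, and filling with 𝐃_{k+1}-cubes keeps `T` (the cubes cover the torus).  Hence the label `(P, Q) = (∅, ∅)` is NOT in the fibre over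
`Ω_{k+1} = ∅`: every label of the fibre has `P ≠ ∅` or `Q ≠ ∅`.  A non-empty `P` carries the factor `χᶜ_{k+1}(P)(V′) = Π_{□′ ∈ P}(1 − χ_{□′}(V′))`, which
vanishes when every cube is (3.2)-small at `V′`; a non-empty `Q` (with `P = ∅`) carries `χ′ᶜ_k(Q)(U, V′) = Π_{□′ ∈ Q} 𝟙{¬(3.3)-small}`, which vanishes when
every cube is (3.3)-small at `(U, V′)`.  So EVERY label weight of the fibre vanishes and `w_k(s′)(U, V′) = 0` — for EVERY residual `ζ` (no unity law needed).
Complement (ζ-unity): `w_k(s′)(U,V′) + a(∅)(V′)·b(∅,∅)(U,V′) ≤ 1` identically — the all-small history's step weight and the all-small LABEL's weight exclude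
each other, with no smallness hypothesis displayed.

WHAT THIS FILE PROVES (0 `sorry`, 0 `def`, standard axioms; `N`-generic; every run `p`, couplings `g`, `A₁`, residual `ζ`).
§1 layer algebra of a term WITHOUT large fields at step `k` (`Z_k = ∅`; covers `k = 0` and the all-small old term): `Zreg_eq_empty_of_Λ`, `Ztilde4_eq_empty_of_Zreg`,
`W32_eq_univ_of_Zreg`, `Bdom_empty_eq_univ_of_Zreg`, `Omega0_empty_empty_eq_univ_of_Zreg`, `fillD_univ`, `univ_mem_unionsOfCubes`, ★ `OmegaOfLabel_empty_empty_eq_univ`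
(`Ω_{k+1}(∅,∅,R,S) = T`), `fst_nonempty_or_of_OmegaOfLabel_eq_empty`.  §2 vanishing label weights: `aWeight_eq_zero_of_nonempty_of_forall_chiFactor_eq_one`,
`bWeight_eq_zero_of_nonempty_of_forall_smallApproxFluct`, `ωOfRecord_eq_zero_of_small_of_OmegaOfLabel_eq_empty`.  §3 ★★ `wOfRecord_allSmall_emptyExt_eq_zero_of_small`
(the (g2)(A) lemma, ζ-free) and `wOfRecord_add_aWeight_mul_bWeight_empty_le_one` (ζ-unity, hypothesis-free complement).  §4 the history (A) EXISTS as an index of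
record: `exists_seq_allSmall_emptyExt` (`0 <` the 𝐃_j-cube sides).  §5 ★★ THE TWO-HISTORY OBSTRUCTION `wOfRecord_two_histories` (same `k ≥ 1`, same `Ω_{k+1} = ∅`,
same `(U, V′)`: `w = 1` on (B), `w = 0` on (A)) and `not_exists_historyBlind_pointwise_pin`.

HONEST FRAMING.  Kernel bookkeeping on def-T's ∕ n02-b's typed resummation (count-neutral): it computes the tree's step weight at two indices; the (3.2)∕(3.3)
smallness hypotheses describe a set of configurations by the values of the PINNED indicators (whose non-emptiness passes through def-R's classical (2.12)
backgrounds and is not claimed here); nothing of Bałaban's is asserted or refuted (in print both histories are legitimate terms of (2.22), controlled by §3's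
bounds).  N11 NOT discharged; K1⁶ NOT closed; counts unmoved (typed 28∕28 · discharged 5∕28).  One finite four-torus programme at fixed `ε = L^{−K}`; NOT ℝ⁴,
NOT OS, NOT a mass gap, NOT Clay.  Sources: [III] (2.1) p.254, (2.3) p.255, (3.2)–(3.5) p.265, (3.16) p.268, (3.20)–(3.21) p.269, §3 p.267, (3.23) p.270.
-/

noncomputable section

open scoped BigOperators

namespace Summit.QuantumFields.YangMills.Theorems.BalabanUVNodesN11AllSmallEmptyExt

open Literature.MathematicalPhysics.QuantumFieldTheory.Balaban1983to89 T4Continuum Node00 B14.Eq218Concrete B14.Sect3Decomp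
open B14SeparationOfRecord (mem_fillD_iff)
open B15Claim189CubePin (cubeOfSite cubeOfSite_mem_cubeIndices mem_cubeEnl_cubeOfSite)
open BalabanUVNodesN11DiagonalPinAboveZero (wOfRecord_seqAllLarge_succ_eq_one)

variable {F : T4Family} {N : ℕ} [NeZero N]

/-! ## §1. Layer algebra of a term without large fields at step `k` (`Z_k = Λ_kᶜ = ∅`) -/

section Layer

variable (P : Params) (s : ℕ)

/-- `fillD` of the whole torus is the whole torus (the `s`-cubes cover it, `0 < s`). [cite: Balaban1988Convergent, (2.1) p.254 (bookkeeping)] -/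
theorem fillD_univ (hs : 0 < s) : fillD P s (Set.univ : Set (Site P 0)) = Set.univ :=
  Set.eq_univ_of_forall fun x =>
    mem_fillD_iff.2 ⟨cubeOfSite s x, cubeOfSite_mem_cubeIndices s hs x, Set.subset_univ _, mem_cubeEnl_cubeOfSite s hs x⟩

/-- The whole torus is a union of cubes of the `s`-partition (`0 < s`): the all-small regions `Ω_j = Λ_j = T` are members of every class `𝐃_j` of record.
[cite: Balaban1988Convergent, (2.1) p.254–255] -/
theorem univ_mem_unionsOfCubes (hs : 0 < s) : (Set.univ : Set (Site P 0)) ∈ unionsOfCubes P s := by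
  have h := hullD_mem_unionsOfCubes P s 0 (Set.univ : Set (Site P 0))
  rwa [hullD_univ P s hs 0] at h

variable (F) (ν : Stage7Numerics) (M : ℕ) (p : B12.RunParams) (g : ℕ → ℝ) (k : ℕ)

omit [NeZero N] in
/-- A term whose last small-field region is the whole torus (`Λ_k = T`; or `k = 0`) has NO large-field region: `Z_k = ∅`.
[cite: Balaban1988Convergent, (2.3) p.255, p.264] -/
theorem Zreg_eq_empty_of_Λ (t : SeqOfRecord F ν M g p.K k) (hΛ : 1 ≤ k → t.Λ k = Set.univ) : Zreg F ν M p g k t = ∅ := by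
  unfold Zreg
  split_ifs with hk
  · rw [hΛ hk, Set.compl_univ]
  · rfl

omit [NeZero N] in
/-- `Z_k = ∅ ⇒ Z̃_k^{∼4} = ∅`. [cite: Balaban1988Convergent, p.264–265 (bookkeeping)] -/
theorem Ztilde4_eq_empty_of_Zreg (t : SeqOfRecord F ν M g p.K k) (hZ : Zreg F ν M p g k t = ∅) : Ztilde4 F ν M p g k t = ∅ := by
  rw [Ztilde4, hZ, hullD_empty, hullD_empty]

omit [NeZero N] in
/-- `Z_k = ∅ ⇒` the (3.2) window is the whole torus. [cite: Balaban1988Convergent, (3.2) p.265] -/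
theorem W32_eq_univ_of_Zreg (t : SeqOfRecord F ν M g p.K k) (hZ : Zreg F ν M p g k t = ∅) : W32 F ν M p g k t = Set.univ := by
  rw [W32, Ztilde4_eq_empty_of_Zreg F ν M p g k t hZ, Set.compl_empty]

omit [NeZero N] in
/-- `Z_k = ∅ ⇒` ALL χ_{k+1}-cubes form the (3.2) range. [cite: Balaban1988Convergent, (3.2) p.265] -/
theorem cubes32_eq_univ_of_Zreg (t : SeqOfRecord F ν M g p.K k) (hZ : Zreg F ν M p g k t = ∅) : cubes32 F ν M p g k t = Finset.univ := by
  ext c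
  simp only [cubes32, W32_eq_univ_of_Zreg F ν M p g k t hZ, mem_cubesIn, Set.subset_univ, Finset.mem_univ]

omit [NeZero N] in
/-- `Z_k = ∅ ⇒ B^{k+1}(∅) = T`. [cite: Balaban1988Convergent, p.265 (bookkeeping)] -/
theorem Bdom_empty_eq_univ_of_Zreg (t : SeqOfRecord F ν M g p.K k) (hZ : Zreg F ν M p g k t = ∅) : Bdom F ν M p g k t ∅ = Set.univ := by
  rw [Bdom, cubesχ_empty, hullD_empty, Ztilde4_eq_empty_of_Zreg F ν M p g k t hZ, Set.union_empty, hullD_empty, Set.compl_empty]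

omit [NeZero N] in
/-- `Z_k = ∅ ⇒` the (3.3) range of the empty `P` is ALL χ_{k+1}-cubes. [cite: Balaban1988Convergent, (3.3) p.265] -/
theorem qcubes_empty_eq_univ_of_Zreg (t : SeqOfRecord F ν M g p.K k) (hZ : Zreg F ν M p g k t = ∅) : qcubes F ν M p g k t ∅ = Finset.univ := by
  ext c
  simp only [qcubes, innerD, Bdom_empty_eq_univ_of_Zreg F ν M p g k t hZ, Set.compl_univ, hullD_empty, Set.compl_empty, mem_cubesIn,
    Set.subset_univ, Finset.mem_univ]

omit [NeZero N] in
/-- `Z_k = ∅ ⇒` **(3.5) for the label `(P, Q) = (∅, ∅)` is the WHOLE TORUS before the guard**. [cite: Balaban1988Convergent, (3.5) p.265] -/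
theorem Omega0_empty_empty_eq_univ_of_Zreg (t : SeqOfRecord F ν M g p.K k) (hZ : Zreg F ν M p g k t = ∅) :
    Omega0 F ν M p g k t ∅ ∅ = Set.univ := by
  rw [Omega0, cubesχ_empty, hullD_empty, Bdom_empty_eq_univ_of_Zreg F ν M p g k t hZ, Set.compl_univ, hullD_empty, Set.empty_union,
    hullD_empty, Set.compl_empty]

omit [NeZero N] in
/-- The typing guard of the empty `P` over an all-small old term (`Λ_k = T` or `k = 0`) is the whole torus. [cite: Balaban1988Convergent, (3.5) p.265 (typing guard)] -/
theorem guardΩ_empty_eq_univ (t : SeqOfRecord F ν M g p.K k) (hΛ : 1 ≤ k → t.Λ k = Set.univ) : guardΩ F ν M p g k t ∅ = Set.univ := by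
  have hL : LamPrev F ν M p g k t = Set.univ := by
    unfold LamPrev
    split_ifs with hk
    · exact hΛ hk
    · rfl
  rw [guardΩ, hL, W32_eq_univ_of_Zreg F ν M p g k t (Zreg_eq_empty_of_Λ F ν M p g k t hΛ), cubesχ_empty, Set.compl_empty,
    Set.univ_inter, Set.univ_inter]

omit [NeZero N] in
/-- **★ OVER AN ALL-SMALL OLD TERM THE LABEL `(P, Q) = (∅, ∅)` HAS `Ω_{k+1} = T`** (whatever `(R, S)`): (3.5) unguarded is `T`, the guard is `T`, and
filling with 𝐃_{k+1}-cubes keeps `T`. [cite: Balaban1988Convergent, (3.5) p.265, (2.1) p.254] -/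
theorem OmegaOfLabel_empty_empty_eq_univ (hD : 0 < sideD F ν M p g k) (t : SeqOfRecord F ν M g p.K k) (hΛ : 1 ≤ k → t.Λ k = Set.univ)
    (RS : Finset (Iχ F ν p g k) × Finset (Iχ F ν p g k)) : OmegaOfLabel F ν M p g k t (∅, ∅, RS) = Set.univ := by
  rw [OmegaOfLabel]
  change fillD (F.P p.K) (sideD F ν M p g k) (Omega0 F ν M p g k t ∅ ∅ ∩ guardΩ F ν M p g k t ∅) = Set.univ
  rw [Omega0_empty_empty_eq_univ_of_Zreg F ν M p g k t (Zreg_eq_empty_of_Λ F ν M p g k t hΛ), guardΩ_empty_eq_univ F ν M p g k t hΛ,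
    Set.univ_inter, fillD_univ _ _ hD]

omit [NeZero N] in
/-- Hence **every label of the fibre over `Ω_{k+1} = ∅` of an all-small old term has `P ≠ ∅` or `Q ≠ ∅`**. [cite: Balaban1988Convergent, (3.5) p.265] -/
theorem fst_nonempty_or_of_OmegaOfLabel_eq_empty (hD : 0 < sideD F ν M p g k) (t : SeqOfRecord F ν M g p.K k) (hΛ : 1 ≤ k → t.Λ k = Set.univ)
    (l : LbOfRecord F ν p g k) (hl : OmegaOfLabel F ν M p g k t l = ∅) : l.1.Nonempty ∨ l.2.1.Nonempty := by
  obtain ⟨Pl, Ql, RS⟩ := l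
  rcases Finset.eq_empty_or_nonempty Pl with hP | hP
  · rcases Finset.eq_empty_or_nonempty Ql with hQ | hQ
    · exfalso
      subst hP; subst hQ
      rw [OmegaOfLabel_empty_empty_eq_univ F ν M p g k hD t hΛ RS] at hl
      haveI : Nonempty (Site (F.P p.K) 0) := ⟨fun _ => 0⟩
      exact Set.empty_ne_univ hl.symm
    · exact Or.inr hQ
  · exact Or.inl hP

end Layer

/-! ## §2. The label weights of the fibre vanish at (3.2)∕(3.3)-small configurations -/

section LabelWeights

variable (F N) (ν : Stage7Numerics) (M : ℕ) (A₁ : ℝ) (p : B12.RunParams) (g : ℕ → ℝ) (k : ℕ)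

/-- **A NON-EMPTY `P` IS KILLED BY (3.2)-SMALLNESS**: `a(P)(V′) = 0` if `P ≠ ∅` and every cube of `P` is (3.2)-small at `V′` (`χᶜ_{k+1}(P) = Π_{□′∈P}(1 − χ) = 0`).
[cite: Balaban1988Convergent, (3.2) p.265] -/
theorem aWeight_eq_zero_of_nonempty_of_forall_chiFactor_eq_one (t : SeqOfRecord F ν M g p.K k) (Pl : Finset (Iχ F ν p g k))
    (hP : Pl.Nonempty) (V' : GaugeField (F.P p.K) (k + 1) (SU N)) (h : ∀ c ∈ Pl, chiFactor F N ν p g k c V' = 1) :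
    aWeight F N ν M p g k t Pl V' = 0 := by
  classical
  unfold aWeight
  split_ifs
  · obtain ⟨c, hc⟩ := hP
    have h0 : chiNextc (sect3DataOfRecord F N ν M p g k t) (epsOfRecord ν g (k + 1)) Pl V' = 0 := by
      unfold chiNextc
      exact Finset.prod_eq_zero hc (by change 1 - chiFactor F N ν p g k c V' = 0; rw [h c hc, sub_self])
    rw [h0, mul_zero]
  · rfl

/-- **A NON-EMPTY `Q` IS KILLED BY (3.3)-SMALLNESS**: `b(P, Q)(U, V′) = 0` if `Q ≠ ∅` and every cube of `Q` satisfies the small-approximate-fluctuation condition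
(3.3) at `(U, V′)` (`χ′ᶜ_k(Q) = 0`). [cite: Balaban1988Convergent, (3.3)–(3.4) p.265] -/
theorem bWeight_eq_zero_of_nonempty_of_forall_smallApproxFluct (t : SeqOfRecord F ν M g p.K k) (Pl Ql : Finset (Iχ F ν p g k))
    (hQ : Ql.Nonempty) (U : GaugeField (F.P p.K) k (SU N)) (V' : GaugeField (F.P p.K) (k + 1) (SU N))
    (h : ∀ c ∈ Ql, SmallApproxFluct (sect3DataOfRecord F N ν M p g k t) (avOfRecord F N p.K) (2 * deltaOfRecord ν g k A₁) U V' c) :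
    bWeight F N ν M p g k A₁ t Pl Ql U V' = 0 := by
  classical
  unfold bWeight
  split_ifs
  · obtain ⟨c, hc⟩ := hQ
    have h0 : chiPrimec (sect3DataOfRecord F N ν M p g k t) (avOfRecord F N p.K) (2 * deltaOfRecord ν g k A₁) Ql U V' = 0 := by
      unfold chiPrimec
      exact Finset.prod_eq_zero hc (by rw [if_pos (h c hc)])
    rw [h0, mul_zero]
  · rfl

/-- **EVERY LABEL WEIGHT OF THE FIBRE VANISHES**: over an all-small old term (`Λ_k = T` or `k = 0`), a label with `Ω_{k+1}(t) = ∅` has weight `ω = 0` at every `(U, V′)`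
that is (3.2)-small on every χ_{k+1}-cube and (3.3)-small on every cube — for EVERY residual `ζ`. [cite: Balaban1988Convergent, (3.2)–(3.5) p.265, (3.16) p.268, (3.20)–(3.21) p.269] -/
theorem ωOfRecord_eq_zero_of_small_of_OmegaOfLabel_eq_empty (ζ : ZetaOfRecord F N ν M) (hD : 0 < sideD F ν M p g k)
    (t : SeqOfRecord F ν M g p.K k) (hΛ : 1 ≤ k → t.Λ k = Set.univ) (l : LbOfRecord F ν p g k) (hl : OmegaOfLabel F ν M p g k t l = ∅)
    (U : GaugeField (F.P p.K) k (SU N)) (V' : GaugeField (F.P p.K) (k + 1) (SU N)) (h32 : ∀ c : Iχ F ν p g k, chiFactor F N ν p g k c V' = 1)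
    (h33 : ∀ c : Iχ F ν p g k, SmallApproxFluct (sect3DataOfRecord F N ν M p g k t) (avOfRecord F N p.K) (2 * deltaOfRecord ν g k A₁) U V' c) :
    ωOfRecord F N ν M p g k A₁ ζ t l U V' = 0 := by
  rcases fst_nonempty_or_of_OmegaOfLabel_eq_empty F ν M p g k hD t hΛ l hl with hP | hQ
  · rw [ωOfRecord, aWeight_eq_zero_of_nonempty_of_forall_chiFactor_eq_one F N ν M p g k t l.1 hP V' fun c _ => h32 c, zero_mul, zero_mul]
  · rw [ωOfRecord, bWeight_eq_zero_of_nonempty_of_forall_smallApproxFluct F N ν M A₁ p g k t l.1 l.2.1 hQ U V' fun c _ => h33 c,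
      mul_zero, zero_mul]

end LabelWeights

/-! ## §3. ★★ History (A): the step weight of the all-small old term extended by `(∅, ∅)` vanishes on the small configurations -/

section HistoryA

variable (F N) (ν : Stage7Numerics) (M : ℕ) (A₁ : ℝ) (p : B12.RunParams) (g : ℕ → ℝ) (k : ℕ)

open Classical in
/-- **★★ (g2)(A) `w_k(s′)(U, V′) = 0`** for a new sequence `s′` with `Ω_{k+1}(s′) = ∅` over an ALL-SMALL old term (`Λ_k(init s′) = T`; at `k = 0` no condition), at every
`(U, V′)` with every χ_{k+1}-cube (3.2)-small at `V′` and (3.3)-small at `(U, V′)` — for EVERY residual `ζ` of def-T's labels (no unity law used): the label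
`(∅, ∅)` is not in the fibre (§1) and every other label's pinned factor vanishes (§2). [cite: Balaban1988Convergent, (3.2)–(3.5) p.265, (3.16) p.268, (3.20)–(3.21) p.269, §3 p.267, (3.23) p.270] -/
theorem wOfRecord_allSmall_emptyExt_eq_zero_of_small (ζ : ZetaOfRecord F N ν M) (hD : 0 < sideD F ν M p g k)
    (s' : SeqOfRecord F ν M g p.K (k + 1)) (hΩ : s'.Ω (k + 1) = ∅) (hΛ : 1 ≤ k → s'.init.Λ k = Set.univ)
    (U : GaugeField (F.P p.K) k (SU N)) (V' : GaugeField (F.P p.K) (k + 1) (SU N)) (h32 : ∀ c : Iχ F ν p g k, chiFactor F N ν p g k c V' = 1)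
    (h33 : ∀ c : Iχ F ν p g k, SmallApproxFluct (sect3DataOfRecord F N ν M p g k s'.init) (avOfRecord F N p.K) (2 * deltaOfRecord ν g k A₁) U V' c) :
    wOfRecord F N ν M A₁ ζ p g k s' U V' = 0 := by
  rw [wOfRecord_eq_sum_filter_OmegaOfLabel F N ν M A₁ p g k ζ s' hΩ U V']
  refine Finset.sum_eq_zero fun l hl => ?_
  exact ωOfRecord_eq_zero_of_small_of_OmegaOfLabel_eq_empty F N ν M A₁ p g k ζ hD s'.init hΛ l (Finset.mem_filter.1 hl).2 U V' h32 h33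

open Classical in
/-- **THE HYPOTHESIS-FREE COMPLEMENT** (ζ-unity): over an all-small old term the step weight of the `(∅, ∅)`-extension and the weight of the all-small LABEL
`a(∅)(V′)·b(∅, ∅)(U, V′) = Π_{□′} χ_{□′}(V′) · Π_{□′} χ′_{□′}(U, V′)` EXCLUDE EACH OTHER: `w_k(s′)(U,V′) + a(∅)(V′) b(∅,∅)(U,V′) ≤ 1` — the first sums `a(P)b(P,Q)` over
labels of the fibre, which never contains `(∅, ∅)` (§1), the total over all `(P,Q)` being `1` ((3.2)∘(3.3)). [cite: Balaban1988Convergent, (3.2)–(3.5) p.265, §3 p.267] -/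
theorem wOfRecord_add_aWeight_mul_bWeight_empty_le_one {ζ : ZetaOfRecord F N ν M} (hζ : IsZetaUnity F N ν M ζ) (hD : 0 < sideD F ν M p g k)
    (s' : SeqOfRecord F ν M g p.K (k + 1)) (hΩ : s'.Ω (k + 1) = ∅) (hΛ : 1 ≤ k → s'.init.Λ k = Set.univ)
    (U : GaugeField (F.P p.K) k (SU N)) (V' : GaugeField (F.P p.K) (k + 1) (SU N)) :
    wOfRecord F N ν M A₁ ζ p g k s' U V' + aWeight F N ν M p g k s'.init ∅ V' * bWeight F N ν M p g k A₁ s'.init ∅ ∅ U V' ≤ 1 := by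
  rw [wOfRecord_eq_sum_aWeight_mul_bWeight_of_Omega_empty F N ν M A₁ p g k hζ s' hΩ U V']
  -- abbreviations
  set f : Finset (Iχ F ν p g k) → Finset (Iχ F ν p g k) → ℝ := fun Pl Ql =>
    aWeight F N ν M p g k s'.init Pl V' * bWeight F N ν M p g k A₁ s'.init Pl Ql U V' with hf
  have hnn : ∀ Pl Ql, 0 ≤ f Pl Ql := fun Pl Ql =>
    mul_nonneg (aWeight_nonneg F N ν M p g k _ Pl V') (bWeight_nonneg F N ν M p g k A₁ _ Pl Ql U V')
  have htot : ∑ Pl : Finset (Iχ F ν p g k), ∑ Ql : Finset (Iχ F ν p g k), f Pl Ql = 1 := by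
    simp only [hf, ← Finset.mul_sum, sum_bWeight, mul_one]
    exact sum_aWeight F N ν M p g k _ V'
  -- the fibre sum with the indicator, plus the `(∅,∅)` term, is at most the total
  have hne : ¬ OmegaOfLabel F ν M p g k s'.init (∅, ∅, (∅, ∅)) = ∅ := by
    rw [OmegaOfLabel_empty_empty_eq_univ F ν M p g k hD s'.init hΛ (∅, ∅)]
    haveI : Nonempty (Site (F.P p.K) 0) := ⟨fun _ => 0⟩
    exact Set.univ_nonempty.ne_empty
  set ind : Finset (Iχ F ν p g k) → Finset (Iχ F ν p g k) → ℝ := fun Pl Ql =>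
    if OmegaOfLabel F ν M p g k s'.init (Pl, Ql, (∅, ∅)) = ∅ then f Pl Ql else 0 with hind
  have hle : ∀ Pl Ql, ind Pl Ql + (if Pl = ∅ ∧ Ql = ∅ then f Pl Ql else 0) ≤ f Pl Ql := by
    intro Pl Ql
    by_cases hPQ : Pl = ∅ ∧ Ql = ∅
    · obtain ⟨rfl, rfl⟩ := hPQ
      simp only [hind, hne, if_false, and_self, if_true, zero_add, le_refl]
    · simp only [hind, hPQ, if_false, add_zero]
      split_ifs
      · exact le_rfl
      · exact hnn Pl Ql
  have hsum : ∑ Pl : Finset (Iχ F ν p g k), ∑ Ql : Finset (Iχ F ν p g k), (if Pl = ∅ ∧ Ql = ∅ then f Pl Ql else 0) = f ∅ ∅ := by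
    rw [Finset.sum_eq_single (∅ : Finset (Iχ F ν p g k))]
    · rw [Finset.sum_eq_single (∅ : Finset (Iχ F ν p g k))]
      · simp
      · intro Ql _ hQ; simp [hQ]
      · intro h; exact absurd (Finset.mem_univ _) h
    · intro Pl _ hP
      exact Finset.sum_eq_zero fun Ql _ => by simp [hP]
    · intro h; exact absurd (Finset.mem_univ _) h
  calc (∑ Pl : Finset (Iχ F ν p g k), ∑ Ql : Finset (Iχ F ν p g k), ind Pl Ql) + f ∅ ∅
      = ∑ Pl : Finset (Iχ F ν p g k), ∑ Ql : Finset (Iχ F ν p g k), (ind Pl Ql + (if Pl = ∅ ∧ Ql = ∅ then f Pl Ql else 0)) := by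
        rw [← hsum, ← Finset.sum_add_distrib]
        exact Finset.sum_congr rfl fun Pl _ => Finset.sum_add_distrib.symm
    _ ≤ ∑ Pl : Finset (Iχ F ν p g k), ∑ Ql : Finset (Iχ F ν p g k), f Pl Ql :=
        Finset.sum_le_sum fun Pl _ => Finset.sum_le_sum fun Ql _ => hle Pl Ql
    _ = 1 := htot

end HistoryA

/-! ## §4. The history (A) is an index of record -/

section Existence

variable (F) (ν : Stage7Numerics) (M : ℕ) (p : B12.RunParams) (g : ℕ → ℝ) (k : ℕ)

omit [NeZero N] in
/-- **THE HISTORY (A) EXISTS**: for `k ≥ 1` there is an index of record of length `k+1` with `Ω_j = Λ_j = T` for `1 ≤ j ≤ k` (the term without large fields,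
n22-b's `Seq.top`) and `Ω_{k+1} = Λ_{k+1} = ∅` — admissible along (2.1) as soon as the 𝐃_j-cubes have positive side (then `T` is a union of cubes, §1).
[cite: Balaban1988Convergent, (2.1) p.254–255, (2.18) p.257, (2.22) p.258] -/
theorem exists_seq_allSmall_emptyExt (hDj : ∀ j, 1 ≤ j → j ≤ k → 0 < dCubeSide (F.P p.K).L M (RkOfRecord (F.P p.K).L ν.r (g j)) j) :
    ∃ s' : SeqOfRecord F ν M g p.K (k + 1),
      s'.Ω (k + 1) = ∅ ∧ s'.Λ (k + 1) = ∅ ∧ (∀ j, 1 ≤ j → j ≤ k → s'.Ω j = Set.univ ∧ s'.Λ j = Set.univ) ∧ (1 ≤ k → s'.init.Λ k = Set.univ) := by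
  have huniv : ∀ j, 1 ≤ j → j ≤ k → (Set.univ : Set (Site (F.P p.K) 0)) ∈ DOfRecord F ν M g p.K j := fun j h1 hj => by
    unfold DOfRecord
    exact univ_mem_unionsOfCubes _ _ (hDj j h1 hj)
  let R : ℕ → Set (Site (F.P p.K) 0) := fun j => if j ≤ k then Set.univ else ∅
  have hch : Chain21 (DOfRecord F ν M g p.K) (k + 1) R R :=
    { memΩ := fun j h1 _ => by
        by_cases hj : j ≤ k
        · simp only [R, if_pos hj]; exact huniv j h1 hj
        · simp only [R, if_neg hj]; unfold DOfRecord; exact empty_mem_unionsOfCubes _ _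
      memΛ := fun j h1 _ => by
        by_cases hj : j ≤ k
        · simp only [R, if_pos hj]; exact huniv j h1 hj
        · simp only [R, if_neg hj]; unfold DOfRecord; exact empty_mem_unionsOfCubes _ _
      Λ_subset := fun _ _ _ => le_rfl
      Ω_succ_subset := fun j _ _ => by
        by_cases hj : j + 1 ≤ k
        · simp only [R, if_pos hj, if_pos (Nat.le_of_succ_le hj)]; exact le_rfl
        · simp only [R, if_neg hj]; exact Set.empty_subset _ }
  refine ⟨Seq.ofChain R R hch, ?_, ?_, ?_, ?_⟩
  · rw [Seq.ofChain_Ω hch (Nat.succ_pos k) le_rfl]; simp [R]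
  · rw [Seq.ofChain_Λ hch (Nat.succ_pos k) le_rfl]; simp [R]
  · intro j h1 hj
    rw [Seq.ofChain_Ω hch h1 (Nat.le_succ_of_le hj), Seq.ofChain_Λ hch h1 (Nat.le_succ_of_le hj)]
    simp [R, hj]
  · intro hk
    rw [Seq.init_Λ _ hk le_rfl, Seq.ofChain_Λ hch hk (Nat.le_succ k)]
    simp [R]

end Existence

/-! ## §5. ★★ The two-history obstruction (director-ym №183 (g2)): same `k`, same `Ω_{k+1} = ∅`, same `(U, V′)` — `w = 1` on (B), `w = 0` on (A) -/

section TwoHistories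

variable (F N) (ν : Stage7Numerics) (M : ℕ) (A₁ : ℝ) (p : B12.RunParams) (g : ℕ → ℝ) {k : ℕ}

/-- **★★ THE TWO HISTORIES**: for `k ≥ 1`, ζ-unity, and any `(U, V′)` (3.2)-small on every χ_{k+1}-cube and (3.3)-small on every cube over the all-small old term:
the all-large-field diagonal (B) and the all-small-then-`(∅,∅)` history (A) share `Ω_{k+1} = ∅` — hence the SAME history-blind slot argument `Y = T` at
generation `k` — yet def-T's resummed step weight is `1` on (B) and `0` on (A). [cite: Balaban1988Convergent, (3.2)–(3.5) p.265, (3.16) p.268, (3.20)–(3.21) p.269, §3 p.267, (3.23) p.270] -/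
theorem wOfRecord_two_histories {ζ : ZetaOfRecord F N ν M} (hζ : IsZetaUnity F N ν M ζ) (hk : 1 ≤ k) (hD : 0 < sideD F ν M p g k)
    (sA : SeqOfRecord F ν M g p.K (k + 1)) (hΩA : sA.Ω (k + 1) = ∅) (hΛA : sA.init.Λ k = Set.univ)
    (U : GaugeField (F.P p.K) k (SU N)) (V' : GaugeField (F.P p.K) (k + 1) (SU N)) (h32 : ∀ c : Iχ F ν p g k, chiFactor F N ν p g k c V' = 1)
    (h33 : ∀ c : Iχ F ν p g k, SmallApproxFluct (sect3DataOfRecord F N ν M p g k sA.init) (avOfRecord F N p.K) (2 * deltaOfRecord ν g k A₁) U V' c) :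
    (seqAllLargeOfRecord F ν M g p.K (k + 1)).Ω (k + 1) = sA.Ω (k + 1) ∧
      wOfRecord F N ν M A₁ ζ p g k (seqAllLargeOfRecord F ν M g p.K (k + 1)) U V' = 1 ∧ wOfRecord F N ν M A₁ ζ p g k sA U V' = 0 :=
  ⟨by rw [seqAllLargeOfRecord_Ω, hΩA], wOfRecord_seqAllLarge_succ_eq_one ν M A₁ p g hζ hk U V',
    wOfRecord_allSmall_emptyExt_eq_zero_of_small F N ν M A₁ p g k ζ hD sA hΩA (fun _ => hΛA) U V' h32 h33⟩

/-- **NO HISTORY-BLIND POINTWISE PIN**: under the same hypotheses there is NO single value `c` (a function of `(p; k, Y = T; U, V′)` alone) equal to def-T's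
resummed step weight at both histories — the kernel form of FINDING №9's «no history-blind pointwise pin serves two histories sharing `Y`» (director-ym №183;
the repair is the v1.7 history-indexed slot). [cite: Balaban1988Convergent, p.267, (3.23) p.270, p.257 L31–34, p.258 L22–25] -/
theorem not_exists_historyBlind_pointwise_pin {ζ : ZetaOfRecord F N ν M} (hζ : IsZetaUnity F N ν M ζ) (hk : 1 ≤ k) (hD : 0 < sideD F ν M p g k)
    (sA : SeqOfRecord F ν M g p.K (k + 1)) (hΩA : sA.Ω (k + 1) = ∅) (hΛA : sA.init.Λ k = Set.univ)
    (U : GaugeField (F.P p.K) k (SU N)) (V' : GaugeField (F.P p.K) (k + 1) (SU N)) (h32 : ∀ c : Iχ F ν p g k, chiFactor F N ν p g k c V' = 1)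
    (h33 : ∀ c : Iχ F ν p g k, SmallApproxFluct (sect3DataOfRecord F N ν M p g k sA.init) (avOfRecord F N p.K) (2 * deltaOfRecord ν g k A₁) U V' c) :
    ¬ ∃ c : ℝ, ∀ s' : SeqOfRecord F ν M g p.K (k + 1), s'.Ω (k + 1) = ∅ →
      (s' = seqAllLargeOfRecord F ν M g p.K (k + 1) ∨ s' = sA) → wOfRecord F N ν M A₁ ζ p g k s' U V' = c := by
  rintro ⟨c, hc⟩
  obtain ⟨hΩB, hB, hA⟩ := wOfRecord_two_histories F N ν M A₁ p g hζ hk hD sA hΩA hΛA U V' h32 h33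
  have h1 : (1 : ℝ) = c := hB ▸ hc _ (hΩB.trans hΩA) (Or.inl rfl)
  have h0 : (0 : ℝ) = c := hA ▸ hc _ hΩA (Or.inr rfl)
  exact one_ne_zero (h1.trans h0.symm)

end TwoHistories

end Summit.QuantumFields.YangMills.Theorems.BalabanUVNodesN11AllSmallEmptyExt

end
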